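import Literature.MathematicalPhysics.QuantumFieldTheory.Balaban1983to89.B9Eq315QkSingleBondLetter
import Literature.MathematicalPhysics.QuantumFieldTheory.Balaban1983to89.Beta.RemainderHasMajQkTower

/-!
# T. Bałaban, *Propagators for lattice gauge theories in a background field*, Commun. Math. Phys. **99** (1985) 389–434
# [Balaban1985BackgroundPropagators] (3.15)–(3.16) p. 393, p. 391 *«the adjoints are taken with respect to natural L² scalar products»*, (3.11) p. 392, (3.49)
# p. 399 with [Balaban1985Averaging] p. 24, (124)–(127) pp. 36–37 and [Balaban1985Variational] (129) p. 297, (190) p. 308: **THE ADJOINT TOWER AVERAGING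
# `Q_k(U)†` (COARSE → FINE) AS THE `hQs`-SHAPED FINITE-RANGE `B11SectG.HasMaj` OF ROW (D4) BETWEEN THE SUP SIZES OF (190) — HEIGHT-FREE ON THE DIAGONAL,
# from ne9-leaf-03's SHARP SINGLE-BOND LETTER by local duality**

CITATION HEADER (lean-in-tree rule 2026-08-18).  Sources: [Balaban1985BackgroundPropagators] (B9; held `paper:balaban1985-cmp99-background-propagators`, journal
page = PDF page + 388): (3.15)–(3.16) p. 393 (the composite averaging `Q_k(U)`), p. 391 (adjoints w.r.t. the weighted `L²` pairings), (3.11) p. 392 (the weights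
`η^d`, `(L^jη)^d`), (3.49) p. 399; [Balaban1985Averaging] (B7; `paper:balaban1985-cmp98-averaging`): p. 24 (locality of the averaging: range one block), (124)–(127)
pp. 36–37 (the normalised average `L^{−(d+1)}Σ …` — ONE fine bond enters with weight `≤ L^{−d}`), Prop. 2 (52)–(54) p. 26; [Balaban1985Variational] (B11):
(129) p. 297 (`H₀ = GQ*(QGQ*)⁻¹` — where `Q*` enters NODE D's derivative (182)), (190) p. 308; [Balaban1984PropagatorsII] (B6) (2.51)–(2.52) p. 232.  Loci as
printed in the headers of the tree files consumed ((SBL) ∕ (SBLT) of ne9-leaf-03 g78) and as read by gens 100–109 of this lineage; [B9] pp. 420–422 ((3.126),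
(3.129) *«H₁B = G₁Q*(QG₁Q*)⁻¹B»*, the sentence before (3.132)) re-read this generation in the held text layer.

WHY THIS FILE (audit cell `pub-balaban`, BINDER row (D4), OWNER lineage `b2b-balaban-beta-an4`, gen 110; plan «Y4c», journal [AN4-G110-INTENT-3]).
V79 `Beta.RemainderOriginTwoLetters.ineq190_origin_of_two_letters` (NODE D at the origin in a background) consumes the adjoint averaging `Q*` through
`hQs : HasMaj bQ′ b3 Qs K_{Qs}` with `K_{Qs} ≥ 0` of finite range and bounded column sums.  The (D4) socket's currency is sup → sup; the cell's `L²` block letter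
of the tower adjoint, `B9Eq315QAdjointBlockDecay.norm_block_adjoint_QkW_le_heightFree`, carries `√(d·c₁∕c₀)` and read pointwise costs a power of the height.
The height-free POINTWISE letter comes instead by LOCAL DUALITY from the SHARP SINGLE-BOND LETTER (t4-ne9-idea-1's remark L-g150-7, typed by ne9-leaf-03 g78):
`(Q_k†h)(b) = (c₁∕c₀)·Σ_c ⟨single-bond column of Q_k at b, h(c)⟩`, the single bond `b` entering `Q_k` with weight `k_{Q,k} = M_φ′·((L^{n+1})^d)⁻¹·e^{100d(d+1)L^dA}·M_φ`
(summable regime `Σ_{j<n+1} α_j ≤ A`) at the `≤ 2d` coarse bonds `c` with `Π(b₋) ∈ {c₋, c₋ + e_{c.2}}` — `B9Eq315QkSingleBondLetter.norm_adjoint_QkW_apply_le_local_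
sharp`: `‖(Q_k†h)(b)‖ ≤ (c₁∕c₀)·k_{Q,k}·2d·M` for `‖h(c)‖ ≤ M` on that zone; on the diagonal `c₀(L^{n+1})^d = c₁` the constant is `M_φ′e^{…}M_φ·2d` — NO power
of the height.  THIS FILE puts it in the socket's currency through the two-carrier lemma `Beta.RemainderHasMajQkTower.hasMaj_supSize_of_local₂` («Y4b» §1):
* §1 **`hasMaj_adjoint_QkW_tower_sup`** — `HasMaj S^{coarse}_m S^{fine}_m ((e ∘ Q_{n+1}(U)† ∘ e′⁻¹)↾ℝ) (M†·𝟙[d_∞(y,u) ≤ 1])`,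
  `M† = (c₁∕c₀)·k_{Q,k}·2d` (any weights); the RANGE needs no separate vanishing lemma: for a source supported on the bonds at `u` with `d_∞(Π(b₋), u) > 1` no bond
  of the zone of `b` is based at `u` (`B9SectCLatticeCarrier.tdist_shift_le′`), so the local datum is `0`; **`hasMaj_adjoint_QkW_tower_sup_diagonal`** — on
  the diagonal `M† = M_φ′·e^{100d(d+1)L^dA}·M_φ·2d`, ONE constant for every height;
* §2 **`exists_hasMaj_adjoint_QkW_tower_of_pdev`** — ON PRINT's CLASS (values in an averaging-closed subgroup, `pdev(U) < α₀·(L^{n+1})^{−2}`, [B7] Prop. 2's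
  numeric window, `2 ≤ L`) the regime is DERIVED by ne9-leaf-02's `B9Eq315QTowerRegularityDisplay.exists_reg_profile_of_pdev` (`Σ ≤ 64(d+1)(d+4)α₀`): `∃ α` (with
  its `hα1`, `hreg`) such that §1's diagonal form holds for `Q_{n+1}(U)` typed with it, `M† = M_φ′·e^{100d(d+1)L^d·64(d+1)(d+4)α₀}·M_φ·2d` —
  `(d, L, α₀, M_φ, M_φ′)` alone.
The kernel facts V79 consumes (`K ≥ 0`, `K ≠ 0 ⟹ dist ≤ d`, row ∕ column sums `≤ M†·e·K_d(1)`) are `Beta.RemainderHasMajQkTower.kernelQ_nonneg` ∕ `kernelQ_loc` ∕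
`kernelQ_rowSum` ∕ `kernelQ_colSum` (same indicator kernel, any constant).  AFTER «Y4a» (`hInv₀`), «Y4b» (`hQ`) AND THIS FILE (`hQs`) the letters of V79 on NE9's
tower that are NOT tree theorems by name are: the ONE analytic letter `hG0` (the height-free sup row of the bond Green's function `G₁,k` — [5] Thm 3.3 (3.42) first
entry; NE9 plan v11, OPEN, owned in the NE9 cell), the structural `hJ` ∕ `hD2` ((3.137)) and the numerics; NODE O (identification of Bałaban's step-`k` objects;
the multi-level `{Ω_j}` case) FROZEN (0).

HONEST SCOPE.  [folklore] composition BY NAME + a two-line support argument; NO estimate of [5] ∕ [4] ∕ [15] is proved here; constants are the cell's crude ones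
(`100d(d+1)L^d`, `2d`, `64(d+1)(d+4)`), not print's `O(1)`; the regularity display is the one the tower operator is typed with (§1 displayed, §2 produced from
(52); the operator's VALUE should not depend on the display — cf. the one-step congruence `B9Eq315QTowerLipschitz.QtorusLin_apply_eq_of_eq`);
`hU1` stays displayed.  NE9's tower = [15]'s case
`Ω_k = T_η`.  Row (D4) class UNCHANGED (instance 0∕1; critical-path width 0 = NODE O; D4 DISCHARGE NO DATE); NOT B12 Thm 2, NOT BetaPertH, NOT continuum, NOT
Clay.  HONEST DEPENDENCY (cell line): continuum YM on T⁴ ⇐ BetaPertH ∧ nine spine estimates (0/9 proved); BetaPertH ⇐ (D1) ∧ (D4) ∧ CAP+tail; G-an2-4 gates asym,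
D1 and NE2/3/4.  NEW file importing `B9Eq315QkSingleBondLetter` (ne9-leaf-03 g78's (SBLT), behind its one-step (SBL)) and «Y4b» `Beta.RemainderHasMajQkTower`;
nothing modified; 0 `def`; standard axioms; no `sorry`.  Net new unproved facts: 0.
-/

noncomputable section

open scoped BigOperators InnerProductSpace

namespace Literature.MathematicalPhysics.QuantumFieldTheory.Balaban1983to89.Beta.RemainderHasMajQkAdjointTower

open B11SectG B11SupSize190
open B4Sect5Torus (TSite tdist tdist_symm)
open B5TorusCover (UT)
open B9Thm34Ext (toB6)
open B9Thm37GlueTorus (torusGeom)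
open B9SectCLatticeCarrier (Bond bpos shift tdist_shift_le')
open B9Eq311L2Pairing (WL2)
open B9Eq319QprimeTorus (fineP blockCoord)
open B9Eq315QTower (towerP UlevOf)
open B9Eq315QTorus (perCfg cornerSite)
open B9Eq316TowerFlatIsOneStep (siteCast towerP_eq_fineP_pow)
open B7Prop1Explicit (U1 Wcx boxVec)
open B7Prop2Explicit (pdev AvgClosed C0 c2')
open B7Prop4GeneralInduction (geom_sum_le_two)
open B11Eq103H1Complex (BondL2K)
open B9Eq326OperatorTower (QkW)
open B9Eq315QkSingleBondLetter (norm_adjoint_QkW_apply_le_local_sharp)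
open B9Eq315QTowerRegularityDisplay (exists_reg_profile_of_pdev)
open Beta.RemainderHasMajQkTower (hasMaj_supSize_of_local₂)

/-! ### Torus bookkeeping (private) -/

section Aux

variable {d : ℕ} {m : Fin d → ℕ}

/-- `ofSite a = y ↔ a = toSite y`. [folklore] -/
private theorem ofSite_eq_iff (a : TSite d m) (y : UT m) : UT.ofSite m a = y ↔ a = UT.toSite m y := by
  constructor
  · rintro rfl; rfl
  · rintro rfl; rfl

/-- The boxes of the coarse bond-position map are its fibres. [folklore] -/
private theorem mem_boxBond_iff (y : UT m) (c : Bond d m) :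
    c ∈ (Finset.univ.filter fun c : Bond d m => bpos c = UT.toSite m y) ↔ UT.ofSite m (bpos c) = y := by
  rw [Finset.mem_filter, ofSite_eq_iff]
  simp

/-- The boxes of the fine-bond big-block map are its fibres. [folklore] -/
private theorem mem_boxFine_iff {L : ℕ} [NeZero L] {n : ℕ} (y : UT m) (b : Bond d (towerP L m (n + 1))) :
    b ∈ (Finset.univ.filter fun b : Bond d (towerP L m (n + 1)) =>
        blockCoord (L ^ (n + 1)) m (siteCast (towerP_eq_fineP_pow L m (n + 1)) (bpos b)) = UT.toSite m y) ↔
      UT.ofSite m (blockCoord (L ^ (n + 1)) m (siteCast (towerP_eq_fineP_pow L m (n + 1)) (bpos b))) = y := by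
  rw [Finset.mem_filter, ofSite_eq_iff]
  simp

end Aux

/-! ## §1  The adjoint tower averaging `Q_k(U)†` (coarse → fine) between the sup sizes: a finite-range majorant, sharp constant `(c₁∕c₀)·k_{Q,k}·2d` -/

section Tower

variable {d : ℕ} (L : ℕ) [NeZero L] (m : Fin d → ℕ) [∀ i, NeZero (m i)] (n : ℕ)
  {𝔸 : Type*} [NormedRing 𝔸] [NormedAlgebra ℂ 𝔸] [CompleteSpace 𝔸] [NormOneClass 𝔸]
  {W : Type} [NormedAddCommGroup W] [InnerProductSpace ℂ W] [FiniteDimensional ℂ W] (φ : W ≃ₗ[ℂ] 𝔸) {c₀ c₁ : ℝ} [Fact (0 < c₀)] [Fact (0 < c₁)]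
  (U : Bond d (towerP L m (n + 1)) → 𝔸ˣ) (hL : 1 ≤ L) (α : ℕ → ℝ) (hα0 : ∀ j, 0 ≤ α j) (hα1 : ∀ j, α j ≤ 1 / 64)
  (hU1 : ∀ (j : ℕ) (x : B7Prop1Explicit.Site d) (κ : Fin d), perCfg (towerP L m (j + 1)) (UlevOf L m (n + 1) U j) x κ ∈ U1 𝔸)
  (hreg : ∀ (j : ℕ) (y : TSite d (towerP L m j)) (κ : Fin d) (r : Fin d → Fin L),
    ‖((Wcx L (perCfg (towerP L m (j + 1)) (UlevOf L m (n + 1) U j)) (cornerSite L y) κ (boxVec L r) : 𝔸ˣ) : 𝔸) - 1‖ ≤ α j)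
  {Mφ Mφ' : ℝ} (hMφ : 0 ≤ Mφ) (hφ : ∀ w, ‖φ w‖ ≤ Mφ * ‖w‖) (hMφ' : 0 ≤ Mφ') (hφ' : ∀ X, ‖φ.symm X‖ ≤ Mφ' * ‖X‖)
  (η₀ L₀ M₀ R : ℝ) (H : Prop)

include hα0 hMφ hφ hMφ' hφ' in
/-- **THE ADJOINT TOWER AVERAGING `Q_k(U)†` AS A FINITE-RANGE BLOCK MAJORANT BETWEEN THE SUP SIZES OF (190).**  For the chain's `Q_{n+1}(U) =
B9Eq326OperatorTower.QkW` (fine bonds, weight `c₀` → coarse bonds, weight `c₁`; fibre read along `φ`; regularity display `α_j ≤ 1∕64`, `hU1`, `hreg`) in a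
summable regime `Σ_{j<n+1} α_j ≤ A`, its ADJOINT with respect to the two weighted `L²` pairings (`LinearMap.adjoint`, coarse → fine) satisfies
`HasMaj S^{coarse}_m S^{fine}_m ((e ∘ Q_{n+1}(U)† ∘ e′⁻¹)↾ℝ) K_{Q†}`, `K_{Q†}(y,u) = M†·𝟙[d_∞(y,u) ≤ 1]`,
`M† = (c₁∕c₀)·(M_φ′·((L^{n+1})^d)⁻¹·e^{100d(d+1)L^dA}·M_φ)·2d` — the VALUE AND the RANGE from ne9-leaf-03's sharp local duality
`B9Eq315QkSingleBondLetter.norm_adjoint_QkW_apply_le_local_sharp` (`Q†` at the fine bond `b` reads the coarse field only at the `≤ 2d` bonds `c` with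
`Π(b₋) ∈ {c₋, c₋ + e_{c.2}}`, against the sharp single-bond letter `k_{Q,k}`): for a source supported on the bonds at a coarse site `u` with `d_∞(Π(b₋), u) > 1`
NO such `c` is based at `u` (`tdist_shift_le'`), so the local datum is `0`.  Through §1 of `Beta.RemainderHasMajQkTower` (`hasMaj_supSize_of_local₂`).
[cite: Balaban1985BackgroundPropagators, (3.15)–(3.16) p.393, (3.11) p.392, p.391, (3.49) p.399] [cite: Balaban1985Averaging, p.24, (124)–(127) pp.36–37]
[cite: Balaban1985Variational, (129) p.297, (190) p.308] [cite: Balaban1984PropagatorsII, (2.51)–(2.52) p.232] -/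
theorem hasMaj_adjoint_QkW_tower_sup (hm : ∀ i, 1 ≤ m i) {A : ℝ} (hA : ∑ j ∈ Finset.range (n + 1), α j ≤ A) :
    HasMaj
      (supSize (toB6 (torusGeom m η₀ L₀ M₀) R H)
        (fun y => Finset.univ.filter fun c : Bond d m => bpos c = UT.toSite m y)
        (fun c => UT.ofSite m (bpos c)) : BlockNorm (toB6 (torusGeom m η₀ L₀ M₀) R H) (Bond d m → W))
      (supSize (toB6 (torusGeom m η₀ L₀ M₀) R H)
        (fun y => Finset.univ.filter fun b : Bond d (towerP L m (n + 1)) =>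
          blockCoord (L ^ (n + 1)) m (siteCast (towerP_eq_fineP_pow L m (n + 1)) (bpos b)) = UT.toSite m y)
        (fun b => UT.ofSite m (blockCoord (L ^ (n + 1)) m (siteCast (towerP_eq_fineP_pow L m (n + 1)) (bpos b)))) :
          BlockNorm (toB6 (torusGeom m η₀ L₀ M₀) R H) (Bond d (towerP L m (n + 1)) → W))
      (((WL2.linearEquiv ℂ ℂ (fun _ : Bond d (towerP L m (n + 1)) => c₀) :
            BondL2K ℂ d (towerP L m (n + 1)) c₀ W ≃ₗ[ℂ] (Bond d (towerP L m (n + 1)) → W)).toLinearMap ∘ₗ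
          LinearMap.adjoint (QkW L m n φ U hL α hα1 hU1 hreg (c₀ := c₀) (c₁ := c₁)) ∘ₗ
          (WL2.linearEquiv ℂ ℂ (fun _ : Bond d m => c₁) : BondL2K ℂ d m c₁ W ≃ₗ[ℂ] (Bond d m → W)).symm.toLinearMap).restrictScalars ℝ)
      (fun y u => if tdist m (UT.toSite m y) (UT.toSite m u) ≤ 1 then
        c₁ / c₀ * (Mφ' * ((((L : ℝ) ^ (n + 1)) ^ d)⁻¹ * Real.exp (100 * d * (d + 1) * (L : ℝ) ^ d * A)) * Mφ) * ((2 * d : ℕ) : ℝ) else 0) := by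
  classical
  have hc₀ : 0 < c₀ := Fact.out
  have hc₁ : 0 < c₁ := Fact.out
  have hM : 0 ≤ c₁ / c₀ * (Mφ' * ((((L : ℝ) ^ (n + 1)) ^ d)⁻¹ * Real.exp (100 * d * (d + 1) * (L : ℝ) ^ d * A)) * Mφ) * ((2 * d : ℕ) : ℝ) := by
    positivity
  refine hasMaj_supSize_of_local₂ (fun y c => mem_boxBond_iff y c) (fun y b => mem_boxFine_iff y b) _
    (fun y u => by split_ifs <;> [exact hM; exact le_rfl]) ?_
  intro u h F hhu hhF b
  -- the carrier element `e′⁻¹ h`, whose values are those of `h`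
  set h' : BondL2K ℂ d m c₁ W :=
    (WL2.linearEquiv ℂ ℂ (fun _ : Bond d m => c₁) : BondL2K ℂ d m c₁ W ≃ₗ[ℂ] (Bond d m → W)).symm h with hh'
  have hhu' : ∀ c : Bond d m, bpos c ≠ UT.toSite m u → WL2.equiv ℂ (fun _ : Bond d m => c₁) W h' c = 0 := by
    intro c hc
    have hne : UT.ofSite m (bpos c) ≠ u := fun e => hc ((ofSite_eq_iff _ _).1 e)
    exact hhu c hne
  have hhF' : ∀ c : Bond d m, ‖WL2.equiv ℂ (fun _ : Bond d m => c₁) W h' c‖ ≤ F := fun c => hhF c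
  -- the value of `(Q_{n+1}(U)† h)(b)` is that of the conjugated map
  have hval : (((WL2.linearEquiv ℂ ℂ (fun _ : Bond d (towerP L m (n + 1)) => c₀) :
            BondL2K ℂ d (towerP L m (n + 1)) c₀ W ≃ₗ[ℂ] (Bond d (towerP L m (n + 1)) → W)).toLinearMap ∘ₗ
          LinearMap.adjoint (QkW L m n φ U hL α hα1 hU1 hreg (c₀ := c₀) (c₁ := c₁)) ∘ₗ
          (WL2.linearEquiv ℂ ℂ (fun _ : Bond d m => c₁) : BondL2K ℂ d m c₁ W ≃ₗ[ℂ] (Bond d m → W)).symm.toLinearMap).restrictScalars ℝ) h b =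
        WL2.equiv ℂ (fun _ : Bond d (towerP L m (n + 1)) => c₀) W
          (LinearMap.adjoint (QkW L m n φ U hL α hα1 hU1 hreg (c₀ := c₀) (c₁ := c₁)) h') b := rfl
  rw [hval, UT.toSite_ofSite]
  by_cases hc : tdist m (blockCoord (L ^ (n + 1)) m (siteCast (towerP_eq_fineP_pow L m (n + 1)) (bpos b))) (UT.toSite m u) ≤ 1
  · -- near field: the sharp local duality with the datum `F`
    rw [if_pos hc]
    have hF0 : 0 ≤ F := by
      obtain ⟨i⟩ : Nonempty (Fin d) := ⟨b.2⟩
      exact (norm_nonneg _).trans (hhF (fun _ => 0, i))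
    exact norm_adjoint_QkW_apply_le_local_sharp L m n φ U hL α hα0 hα1 hU1 hreg hMφ hφ hMφ' hφ' hA h' b hF0 (fun c _ => hhF' c)
  · -- far field: no bond of the zone of `b` is based at `u`, so the local datum is `0`
    rw [if_neg hc, zero_mul]
    have hlt : 1 < tdist m (blockCoord (L ^ (n + 1)) m (siteCast (towerP_eq_fineP_pow L m (n + 1)) (bpos b))) (UT.toSite m u) :=
      not_le.mp hc
    have hzone : ∀ c : Bond d m,
        (blockCoord (L ^ (n + 1)) m (siteCast (towerP_eq_fineP_pow L m (n + 1)) b.1) = c.1 ∨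
          blockCoord (L ^ (n + 1)) m (siteCast (towerP_eq_fineP_pow L m (n + 1)) b.1) = shift c.2 c.1) →
        ‖WL2.equiv ℂ (fun _ : Bond d m => c₁) W h' c‖ ≤ 0 := by
      intro c hcz
      have hne : bpos c ≠ UT.toSite m u := by
        intro hcu
        rcases hcz with h1 | h2
        · have : tdist m (blockCoord (L ^ (n + 1)) m (siteCast (towerP_eq_fineP_pow L m (n + 1)) (bpos b))) (UT.toSite m u) = 0 := by
            rw [← hcu, show bpos c = c.1 from rfl, ← h1]
            exact B4Sect5Torus.tdist_self m _
          linarith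
        · have : tdist m (blockCoord (L ^ (n + 1)) m (siteCast (towerP_eq_fineP_pow L m (n + 1)) (bpos b))) (UT.toSite m u) ≤ 1 := by
            rw [← hcu, show bpos c = c.1 from rfl, show bpos b = b.1 from rfl, h2]
            exact tdist_shift_le' hm c.2 c.1
          linarith
      rw [hhu' c hne, norm_zero]
    have h := norm_adjoint_QkW_apply_le_local_sharp L m n φ U hL α hα0 hα1 hU1 hreg hMφ hφ hMφ' hφ' (c₀ := c₀) (c₁ := c₁) hA h' b le_rfl hzone
    simpa using h

include hα0 hMφ hφ hMφ' hφ' in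
/-- **ON THE DIAGONAL `c₀(L^{n+1})^d = c₁` THE CONSTANT IS HEIGHT-FREE**: `M† = M_φ′·e^{100d(d+1)L^dA}·M_φ·2d`. [folklore]
[cite: Balaban1985BackgroundPropagators, (3.11) p.392, (3.16) p.393] [cite: Balaban1985Averaging, (126)–(127) pp.36–37] [cite: Balaban1985Variational, (190) p.308] -/
theorem hasMaj_adjoint_QkW_tower_sup_diagonal (hm : ∀ i, 1 ≤ m i) (hw : c₀ * ((L : ℝ) ^ (n + 1)) ^ d = c₁) {A : ℝ}
    (hA : ∑ j ∈ Finset.range (n + 1), α j ≤ A) :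
    HasMaj
      (supSize (toB6 (torusGeom m η₀ L₀ M₀) R H)
        (fun y => Finset.univ.filter fun c : Bond d m => bpos c = UT.toSite m y)
        (fun c => UT.ofSite m (bpos c)) : BlockNorm (toB6 (torusGeom m η₀ L₀ M₀) R H) (Bond d m → W))
      (supSize (toB6 (torusGeom m η₀ L₀ M₀) R H)
        (fun y => Finset.univ.filter fun b : Bond d (towerP L m (n + 1)) =>
          blockCoord (L ^ (n + 1)) m (siteCast (towerP_eq_fineP_pow L m (n + 1)) (bpos b)) = UT.toSite m y)
        (fun b => UT.ofSite m (blockCoord (L ^ (n + 1)) m (siteCast (towerP_eq_fineP_pow L m (n + 1)) (bpos b)))) :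
          BlockNorm (toB6 (torusGeom m η₀ L₀ M₀) R H) (Bond d (towerP L m (n + 1)) → W))
      (((WL2.linearEquiv ℂ ℂ (fun _ : Bond d (towerP L m (n + 1)) => c₀) :
            BondL2K ℂ d (towerP L m (n + 1)) c₀ W ≃ₗ[ℂ] (Bond d (towerP L m (n + 1)) → W)).toLinearMap ∘ₗ
          LinearMap.adjoint (QkW L m n φ U hL α hα1 hU1 hreg (c₀ := c₀) (c₁ := c₁)) ∘ₗ
          (WL2.linearEquiv ℂ ℂ (fun _ : Bond d m => c₁) : BondL2K ℂ d m c₁ W ≃ₗ[ℂ] (Bond d m → W)).symm.toLinearMap).restrictScalars ℝ)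
      (fun y u => if tdist m (UT.toSite m y) (UT.toSite m u) ≤ 1 then
        Mφ' * Real.exp (100 * d * (d + 1) * (L : ℝ) ^ d * A) * Mφ * ((2 * d : ℕ) : ℝ) else 0) := by
  have hc₀ : 0 < c₀ := Fact.out
  have hLp : (0 : ℝ) < ((L : ℝ) ^ (n + 1)) ^ d := by
    have hL0 : (0 : ℝ) < L := by exact_mod_cast hL
    positivity
  have hconst : c₁ / c₀ * (Mφ' * ((((L : ℝ) ^ (n + 1)) ^ d)⁻¹ * Real.exp (100 * d * (d + 1) * (L : ℝ) ^ d * A)) * Mφ) * ((2 * d : ℕ) : ℝ) =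
      Mφ' * Real.exp (100 * d * (d + 1) * (L : ℝ) ^ d * A) * Mφ * ((2 * d : ℕ) : ℝ) := by
    rw [← hw]
    field_simp
  have h := hasMaj_adjoint_QkW_tower_sup L m n φ U hL α hα0 hα1 hU1 hreg hMφ hφ hMφ' hφ' η₀ L₀ M₀ R H (c₀ := c₀) (c₁ := c₁) hm hA
  exact h.mono fun a b => by rw [hconst]

end Tower

/-! ## §2  Print's class: the display READ OFF the plaquette window (52) — `∃ α`, ONE constant `M†(d, L, α₀, M_φ, M_φ′)` on the diagonal -/

section Plaquette

variable {d : ℕ} (L : ℕ) [NeZero L] (m : Fin d → ℕ) [∀ i, NeZero (m i)] (n : ℕ)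
  {𝔸 : Type*} [NormedRing 𝔸] [NormedAlgebra ℂ 𝔸] [CompleteSpace 𝔸] [NormOneClass 𝔸]
  {W : Type} [NormedAddCommGroup W] [InnerProductSpace ℂ W] [FiniteDimensional ℂ W] (φ : W ≃ₗ[ℂ] 𝔸) {c₀ c₁ : ℝ} [Fact (0 < c₀)] [Fact (0 < c₁)]
  (U : Bond d (towerP L m (n + 1)) → 𝔸ˣ) (hL : 1 ≤ L) (hL2 : 2 ≤ L)
  (hU1 : ∀ (j : ℕ) (x : B7Prop1Explicit.Site d) (κ : Fin d), perCfg (towerP L m (j + 1)) (UlevOf L m (n + 1) U j) x κ ∈ U1 𝔸)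
  {G : Subgroup 𝔸ˣ} (hG : AvgClosed d L G) (hU : ∀ (x : B7Prop1Explicit.Site d) (κ : Fin d), perCfg (towerP L m (n + 1)) U x κ ∈ G)
  {α₀ : ℝ} (hα : 0 < α₀) (hα3 : C0 d * α₀ ≤ 1 / 3) (hα4 : 4 * α₀ ≤ c2' d L)
  (h52 : pdev (perCfg (towerP L m (n + 1)) U) < α₀ * (((L : ℝ) ^ (n + 1))⁻¹) ^ 2)
  {Mφ Mφ' : ℝ} (hMφ : 0 ≤ Mφ) (hφ : ∀ w, ‖φ w‖ ≤ Mφ * ‖w‖) (hMφ' : 0 ≤ Mφ') (hφ' : ∀ X, ‖φ.symm X‖ ≤ Mφ' * ‖X‖)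

include hL2 hG hU hα hα3 hα4 h52 hMφ hφ hMφ' hφ' in
/-- **ON PRINT's CLASS, ON THE DIAGONAL**: for `U` with values in an averaging-closed subgroup and `pdev(U) < α₀·(L^{n+1})^{−2}` ([B7] Prop. 2's window),
ne9-leaf-02's `exists_reg_profile_of_pdev` supplies ONE display `α` (geometric on the levels, `Σ_{j<n+1} α_j ≤ 64(d+1)(d+4)α₀`), and for `Q_{n+1}(U)` typed
with it, on the diagonal `c₀(L^{n+1})^d = c₁`: `HasMaj S^{coarse}_m S^{fine}_m ((e ∘ Q_{n+1}(U)† ∘ e′⁻¹)↾ℝ) (M†·𝟙[d_∞ ≤ 1])`,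
`M† = M_φ′·e^{100d(d+1)L^d·64(d+1)(d+4)α₀}·M_φ·2d` — a function of `(d, L, α₀, M_φ, M_φ′)` ALONE, for every height, period and geometry.
[cite: Balaban1985Averaging, Proposition 2 (52)–(54) p.26, (126)–(127) pp.36–37, (131) p.38] [cite: Balaban1985BackgroundPropagators, (3.15)–(3.16) p.393, (3.35) p.396, (3.11) p.392]
[cite: Balaban1985Variational, (190) p.308] [cite: Balaban1984PropagatorsII, (2.51)–(2.52) p.232] -/
theorem exists_hasMaj_adjoint_QkW_tower_of_pdev (hm : ∀ i, 1 ≤ m i) (hw : c₀ * ((L : ℝ) ^ (n + 1)) ^ d = c₁) :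
    ∃ (α : ℕ → ℝ) (hα1 : ∀ j, α j ≤ 1 / 64)
      (hreg : ∀ (j : ℕ) (y : TSite d (towerP L m j)) (κ : Fin d) (r : Fin d → Fin L),
        ‖((Wcx L (perCfg (towerP L m (j + 1)) (UlevOf L m (n + 1) U j)) (cornerSite L y) κ (boxVec L r) : 𝔸ˣ) : 𝔸) - 1‖ ≤ α j),
      (∀ j, 0 ≤ α j) ∧ (∀ j < n + 1, α j ≤ 32 * ((d : ℝ) + 1) * ((d : ℝ) + 4) * α₀ * (((L : ℝ) ^ 2)⁻¹) ^ j) ∧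
      ∀ (η₀ L₀ M₀ R : ℝ) (H : Prop),
        HasMaj
          (supSize (toB6 (torusGeom m η₀ L₀ M₀) R H)
            (fun y => Finset.univ.filter fun c : Bond d m => bpos c = UT.toSite m y)
            (fun c => UT.ofSite m (bpos c)) : BlockNorm (toB6 (torusGeom m η₀ L₀ M₀) R H) (Bond d m → W))
          (supSize (toB6 (torusGeom m η₀ L₀ M₀) R H)
            (fun y => Finset.univ.filter fun b : Bond d (towerP L m (n + 1)) =>
              blockCoord (L ^ (n + 1)) m (siteCast (towerP_eq_fineP_pow L m (n + 1)) (bpos b)) = UT.toSite m y)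
            (fun b => UT.ofSite m (blockCoord (L ^ (n + 1)) m (siteCast (towerP_eq_fineP_pow L m (n + 1)) (bpos b)))) :
              BlockNorm (toB6 (torusGeom m η₀ L₀ M₀) R H) (Bond d (towerP L m (n + 1)) → W))
          (((WL2.linearEquiv ℂ ℂ (fun _ : Bond d (towerP L m (n + 1)) => c₀) :
                BondL2K ℂ d (towerP L m (n + 1)) c₀ W ≃ₗ[ℂ] (Bond d (towerP L m (n + 1)) → W)).toLinearMap ∘ₗ
              LinearMap.adjoint (QkW L m n φ U hL α hα1 hU1 hreg (c₀ := c₀) (c₁ := c₁)) ∘ₗ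
              (WL2.linearEquiv ℂ ℂ (fun _ : Bond d m => c₁) : BondL2K ℂ d m c₁ W ≃ₗ[ℂ] (Bond d m → W)).symm.toLinearMap).restrictScalars ℝ)
          (fun y u => if tdist m (UT.toSite m y) (UT.toSite m u) ≤ 1 then
            Mφ' * Real.exp (100 * d * (d + 1) * (L : ℝ) ^ d * (64 * ((d : ℝ) + 1) * ((d : ℝ) + 4) * α₀)) * Mφ * ((2 * d : ℕ) : ℝ) else 0) := by
  obtain ⟨α, hα0, hα1, hreg, hprof⟩ := exists_reg_profile_of_pdev L m (n + 1) U hL2 hG hU hα hα3 hα4 h52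
  have hL4 : (4 : ℝ) ≤ (L : ℝ) ^ 2 := by
    have h2 : (2 : ℝ) ≤ L := by exact_mod_cast hL2
    nlinarith
  have hr0 : (0 : ℝ) ≤ ((L : ℝ) ^ 2)⁻¹ := by positivity
  have hr : ((L : ℝ) ^ 2)⁻¹ ≤ 1 / 2 := by
    rw [inv_le_comm₀ (by positivity) (by norm_num)]
    linarith
  have hA : ∑ j ∈ Finset.range (n + 1), α j ≤ 64 * ((d : ℝ) + 1) * ((d : ℝ) + 4) * α₀ := by
    calc ∑ j ∈ Finset.range (n + 1), α j
        ≤ ∑ j ∈ Finset.range (n + 1), 32 * ((d : ℝ) + 1) * ((d : ℝ) + 4) * α₀ * (((L : ℝ) ^ 2)⁻¹) ^ j :=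
          Finset.sum_le_sum fun j hj => hprof j (Finset.mem_range.mp hj)
      _ = 32 * ((d : ℝ) + 1) * ((d : ℝ) + 4) * α₀ * ∑ j ∈ Finset.range (n + 1), (((L : ℝ) ^ 2)⁻¹) ^ j := by
          rw [Finset.mul_sum]
      _ ≤ 32 * ((d : ℝ) + 1) * ((d : ℝ) + 4) * α₀ * 2 :=
          mul_le_mul_of_nonneg_left (geom_sum_le_two hr0 hr (n + 1)) (by positivity)
      _ = 64 * ((d : ℝ) + 1) * ((d : ℝ) + 4) * α₀ := by ring
  exact ⟨α, hα1, hreg, hα0, hprof, fun η₀ L₀ M₀ R H =>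
    hasMaj_adjoint_QkW_tower_sup_diagonal L m n φ U hL α hα0 hα1 hU1 hreg hMφ hφ hMφ' hφ' η₀ L₀ M₀ R H (c₀ := c₀) (c₁ := c₁) hm hw hA⟩

end Plaquette

end Literature.MathematicalPhysics.QuantumFieldTheory.Balaban1983to89.Beta.RemainderHasMajQkAdjointTower

end
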